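/-
Copyright: the b2b-balaban T⁴-continuum CRUX team, row NE7b owner lineage `t4-ne7b-p1` (gen 111). Project licence.
-/
import Mathlib.Analysis.InnerProductSpace.PiL2
import Mathlib.Topology.Algebra.Module.FiniteDimension

/-!
# THE JUNCTION FROM THE TREE's MATRIX ∕ `dotProduct` CURRENCY TO THE HARD-STEP CELL's NORMED-SPACE SHAPES: on `EuclideanSpace ℝ ι` the form
# of a matrix `⟨x, Ay⟩`, the map of a rectangular matrix and the block-averaging section ARE continuous (bi)linear maps, and every letter
# the cell's shapes consume (coercivity, kernel coercivity, ceiling, domination by a pullback, exact section, operator norm, transported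
# form) TRANSFERS VERBATIM from its `dotProduct` statement (row NE7b, node U5c; Mathlib only; [folklore] finite-dimensional linear algebra)

Cell `pub-balaban`, sub-cell `t4`, spine estimate NE7b (`T4WeightBudget.RelWeightBound`; the cell's OWN estimate — NOT PRINTED in [Bałaban 1983–89],
NOT PROVED).  Crux-route work under `Spine/NE7b/` by the row OWNER (`t4-ne7b-p1` gen 111) under FREEZE (0)'s crux-prover clause; NOTHING of
Bałaban's is named; no `T4Continuum/Support` leaf typed; no `def` (the continuous maps are CARRIED BY THEIR CHARACTERISING HYPOTHESES `hQ ∕ hR ∕ hD ∕ hT`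
below and shown to EXIST in §2); zero `sorry`.  Imports: Mathlib only.

WHY (owner word W-ne7bp1-g111-2 ∕ reading R-ne7bp1-g111-1).  The hard-step cell's shapes — `…DominationTransfer` (`hRQ : ∀ x, γ·R (D x)(D x) ≤ Q x x`,
`hR : ∀ g, D₂ g = 0 → m‖g‖² ≤ R g g`, `hT : D (T g) = g`), `…TransportedFormCoercivity`, `…HardStepSemigroup(Tower)`, `…TransportedHessianEnergyCeiling`,
`…HardStepTowerBox` — are stated over real normed spaces with `Q : E →L[ℝ] E →L[ℝ] ℝ`, `D : E →L[ℝ] F`, `T : F →L[ℝ] E`.  The tree's by-value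
suppliers for the free field are stated in MATRIX currency: `v ⬝ᵥ (A *ᵥ v)`, `D *ᵥ v = 0`, `D * T = 1` (the torus columns `B1RG242Torus` ∕
`B4Ineq115Torus` ∕ `Beta.Ineq167Operator`, the block-average letters `…BlockAverageLetters`, this lineage's `…SoftTowerRegionLetters`).  THIS FILE is
the ONE-TIME junction between the two currencies on the canonical finite carrier `EuclideanSpace ℝ ι` (`‖x‖² = Σ xᵢ²`): §1 the dictionary
`⟪x, y⟫ = x ⬝ᵥ y` (`‖x‖² = x ⬝ᵥ x` inline); §2 EXISTENCE of the continuous bilinear form of a square matrix, of the continuous map of a rectangular matrix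
(so the characterising hypotheses below are inhabited — the maps are `(innerSL ℝ).bilinearComp id (toEuclideanCLM A)` and `toEuclideanLin D` made
continuous); §3 the LETTER TRANSFER, each a one-liner: coercivity, ceiling, kernel coercivity, domination by a pullback, exact section, operator norm
from a quadratic bound, and the matrix of the transported form `Q.bilinearComp T T` (`= Tᵀ A T` in coordinates).

WHAT IS PROVED ([folklore]; `ι κ` finite types; `E := EuclideanSpace ℝ ι`, `F := EuclideanSpace ℝ κ`; `ofLp` the coordinate map; hypotheses
`hQ : ∀ x y, Q x y = ofLp x ⬝ᵥ (A *ᵥ ofLp y)`, `hR` likewise for `R` and a matrix `S` on `κ`, `hD : ∀ x, ofLp (D x) = Dm *ᵥ ofLp x`,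
`hT : ∀ g, ofLp (T g) = Tm *ᵥ ofLp g`):
* §1 `inner_eq_dot`, `eq_zero_iff_ofLp` (the identity `‖x‖² = x ⬝ᵥ x` is the tree's `…NE7K1LinWalkExpansion.norm_sq_eq_dot`; used inline here).
* §2 `exists_form` (`∃ Q, ∀ x y, Q x y = ofLp x ⬝ᵥ (A *ᵥ ofLp y)`), `exists_map` (`∃ D, ∀ x, ofLp (D x) = Dm *ᵥ ofLp x`).
* §3 `coercive_transfer` (`(∀ v, m·(v ⬝ᵥ v) ≤ v ⬝ᵥ A v) → ∀ x, m‖x‖² ≤ Q x x`), `ceiling_transfer` (`(∀ v, v ⬝ᵥ A v ≤ C·(v ⬝ᵥ v)) → Q x x ≤ C‖x‖²`),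
  `kerCoercive_transfer` (`(∀ v, Dm v = 0 → m·(v ⬝ᵥ v) ≤ v ⬝ᵥ A v) → ∀ x, D x = 0 → m‖x‖² ≤ Q x x` — DMT's `hR`, TFC's `hco`),
  `domination_transfer` (`(∀ v, γ·((Dm v) ⬝ᵥ S (Dm v)) ≤ v ⬝ᵥ A v) → ∀ x, γ·R (D x) (D x) ≤ Q x x` — DMT's `hRQ`), `section_transfer`
  (`Dm * Tm = 1 → ∀ g, D (T g) = g` — DMT's ∕ HSSG's `hT`), `opNorm_transfer` (`(∀ v, (Tm v) ⬝ᵥ (Tm v) ≤ N²·(v ⬝ᵥ v)) → ‖T‖ ≤ N` — the chart ∕ `‖M₂‖ ≤ μ`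
  letters), `bilinearComp_transfer` (`(Q.bilinearComp T T) g h = ofLp g ⬝ᵥ ((Tmᵀ * A * Tm) *ᵥ ofLp h)` — the transported form is a matrix form again,
  so the letters iterate along a tower).
* §4 toy (`ι = κ = Fin 1`, `A = Dm = Tm = 1`).

NOT HERE (honest): the `ℓ²(ℤ^d)` (`lp`) carrier for the whole-lattice column (`…FreeFieldBlockingLetters`); any by-value letter (they are the suppliers'
— this file only moves them); anything of Bałaban's ((A3) ∕ (A1c), NC-NE7b-α UNRULED).  BY-NAME EFFECT ON THE WALL: NONE.  NE7b NOT PRINTED ∕ NOT PROVED;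
spine PROVED 0∕9; rung (B)+1 on a FINITE torus — NOT infinite volume, NOT the mass gap, NOT Clay.  HONEST DEPENDENCY: continuum YM on T⁴ ⇐ BetaPertH
∧ nine spine estimates (0∕9 proved); BetaPertH ⇐ (D1) ∧ (D4) ∧ CAP+tail; G-an2-4 gates asym, D1 and NE2∕3∕4.
-/

set_option autoImplicit false

namespace Summit.QuantumFields.BalabanUV.T4Continuum.NE7b.MatrixFormJunction

open Matrix WithLp

variable {ι κ : Type*} [Fintype ι] [Fintype κ]

/-! ## §1. The dictionary on `EuclideanSpace ℝ ι` -/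

/-- `⟪x, y⟫ = x ⬝ᵥ y` in coordinates (real scalars). [folklore] -/
theorem inner_eq_dot (x y : EuclideanSpace ℝ ι) : inner ℝ x y = ofLp x ⬝ᵥ ofLp y := by
  rw [EuclideanSpace.inner_eq_star_dotProduct, dotProduct_comm]
  simp

omit [Fintype ι] in
/-- `x = 0 ↔ ofLp x = 0`. [folklore] -/
theorem eq_zero_iff_ofLp (x : EuclideanSpace ℝ ι) : x = 0 ↔ ofLp x = 0 :=
  (WithLp.ofLp_eq_zero 2).symm

/-! ## §2. The characterising hypotheses are inhabited -/

/-- **THE FORM OF A MATRIX IS A CONTINUOUS BILINEAR FORM**: for every real square matrix `A` there is `Q : E →L E →L ℝ` with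
`Q x y = x ⬝ᵥ (A y)` (namely `(innerSL ℝ).bilinearComp id (toEuclideanLin A)`, continuous by finite dimension). [folklore] -/
theorem exists_form [DecidableEq ι] (A : Matrix ι ι ℝ) :
    ∃ Q : EuclideanSpace ℝ ι →L[ℝ] EuclideanSpace ℝ ι →L[ℝ] ℝ, ∀ x y, Q x y = ofLp x ⬝ᵥ (A *ᵥ ofLp y) := by
  refine ⟨(innerSL ℝ).bilinearComp (ContinuousLinearMap.id ℝ _)
    (LinearMap.toContinuousLinearMap (Matrix.toEuclideanLin (m := ι) (n := ι) (𝕜 := ℝ) A)), fun x y => ?_⟩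
  rw [ContinuousLinearMap.bilinearComp_apply, ContinuousLinearMap.id_apply, LinearMap.coe_toContinuousLinearMap']
  show inner ℝ x _ = _
  rw [inner_eq_dot, Matrix.toEuclideanLin, Matrix.toLpLin_apply, WithLp.ofLp_toLp]

/-- **THE MAP OF A RECTANGULAR MATRIX IS A CONTINUOUS LINEAR MAP** `E →L F` with `ofLp (D x) = Dm *ᵥ ofLp x` (namely `toEuclideanLin Dm`,
continuous by finite dimension). [folklore] -/
theorem exists_map [DecidableEq ι] (Dm : Matrix κ ι ℝ) :
    ∃ D : EuclideanSpace ℝ ι →L[ℝ] EuclideanSpace ℝ κ, ∀ x, ofLp (D x) = Dm *ᵥ ofLp x := by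
  refine ⟨LinearMap.toContinuousLinearMap (Matrix.toEuclideanLin (m := κ) (n := ι) (𝕜 := ℝ) Dm), fun x => ?_⟩
  rw [LinearMap.coe_toContinuousLinearMap', Matrix.toEuclideanLin, Matrix.toLpLin_apply]

/-! ## §3. The letter transfer -/

section Transfer

variable {Q : EuclideanSpace ℝ ι →L[ℝ] EuclideanSpace ℝ ι →L[ℝ] ℝ} {A : Matrix ι ι ℝ}
  {R : EuclideanSpace ℝ κ →L[ℝ] EuclideanSpace ℝ κ →L[ℝ] ℝ} {S : Matrix κ κ ℝ}
  {D : EuclideanSpace ℝ ι →L[ℝ] EuclideanSpace ℝ κ} {Dm : Matrix κ ι ℝ}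
  {T : EuclideanSpace ℝ κ →L[ℝ] EuclideanSpace ℝ ι} {Tm : Matrix ι κ ℝ}

/-- COERCIVITY transfers: `(∀ v, m·(v ⬝ᵥ v) ≤ v ⬝ᵥ A v) ⟹ ∀ x, m‖x‖² ≤ Q x x`. [folklore] -/
theorem coercive_transfer (hQ : ∀ x y, Q x y = ofLp x ⬝ᵥ (A *ᵥ ofLp y)) {m : ℝ}
    (h : ∀ v : ι → ℝ, m * (v ⬝ᵥ v) ≤ v ⬝ᵥ (A *ᵥ v)) (x : EuclideanSpace ℝ ι) : m * ‖x‖ ^ 2 ≤ Q x x := by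
  have hn : ‖x‖ ^ 2 = ofLp x ⬝ᵥ ofLp x := by rw [EuclideanSpace.norm_sq_eq]; simp [dotProduct, sq]
  rw [hQ, hn]; exact h _

/-- CEILING transfers: `(∀ v, v ⬝ᵥ A v ≤ C·(v ⬝ᵥ v)) ⟹ ∀ x, Q x x ≤ C‖x‖²`. [folklore] -/
theorem ceiling_transfer (hQ : ∀ x y, Q x y = ofLp x ⬝ᵥ (A *ᵥ ofLp y)) {C : ℝ}
    (h : ∀ v : ι → ℝ, v ⬝ᵥ (A *ᵥ v) ≤ C * (v ⬝ᵥ v)) (x : EuclideanSpace ℝ ι) : Q x x ≤ C * ‖x‖ ^ 2 := by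
  have hn : ‖x‖ ^ 2 = ofLp x ⬝ᵥ ofLp x := by rw [EuclideanSpace.norm_sq_eq]; simp [dotProduct, sq]
  rw [hQ, hn]; exact h _

omit [Fintype κ] in
/-- KERNEL COERCIVITY transfers (DMT's `hR`, TFC's `hco`): `(∀ v, Dm v = 0 → m·(v ⬝ᵥ v) ≤ v ⬝ᵥ A v) ⟹ ∀ x, D x = 0 → m‖x‖² ≤ Q x x`.
[folklore] -/
theorem kerCoercive_transfer (hQ : ∀ x y, Q x y = ofLp x ⬝ᵥ (A *ᵥ ofLp y)) (hD : ∀ x, ofLp (D x) = Dm *ᵥ ofLp x)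
    {m : ℝ} (h : ∀ v : ι → ℝ, Dm *ᵥ v = 0 → m * (v ⬝ᵥ v) ≤ v ⬝ᵥ (A *ᵥ v)) (x : EuclideanSpace ℝ ι) (hx : D x = 0) :
    m * ‖x‖ ^ 2 ≤ Q x x := by
  have hn : ‖x‖ ^ 2 = ofLp x ⬝ᵥ ofLp x := by rw [EuclideanSpace.norm_sq_eq]; simp [dotProduct, sq]
  rw [hQ, hn]
  refine h _ ?_
  rw [← hD, hx]; rfl

/-- DOMINATION BY A PULLBACK transfers (DMT's `hRQ`): `(∀ v, γ·((Dm v) ⬝ᵥ S (Dm v)) ≤ v ⬝ᵥ A v) ⟹ ∀ x, γ·R (D x) (D x) ≤ Q x x`. [folklore] -/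
theorem domination_transfer (hQ : ∀ x y, Q x y = ofLp x ⬝ᵥ (A *ᵥ ofLp y)) (hR : ∀ g h, R g h = ofLp g ⬝ᵥ (S *ᵥ ofLp h))
    (hD : ∀ x, ofLp (D x) = Dm *ᵥ ofLp x) {γ : ℝ}
    (h : ∀ v : ι → ℝ, γ * ((Dm *ᵥ v) ⬝ᵥ (S *ᵥ (Dm *ᵥ v))) ≤ v ⬝ᵥ (A *ᵥ v)) (x : EuclideanSpace ℝ ι) :
    γ * R (D x) (D x) ≤ Q x x := by
  rw [hQ, hR, hD]; exact h _

/-- EXACT SECTION transfers (DMT's ∕ HSSG's `hT`): `Dm * Tm = 1 ⟹ ∀ g, D (T g) = g`. [folklore] -/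
theorem section_transfer [DecidableEq κ] (hD : ∀ x, ofLp (D x) = Dm *ᵥ ofLp x) (hT : ∀ g, ofLp (T g) = Tm *ᵥ ofLp g)
    (h : Dm * Tm = 1) (g : EuclideanSpace ℝ κ) : D (T g) = g := by
  apply WithLp.ofLp_injective 2
  rw [hD, hT, Matrix.mulVec_mulVec, h, Matrix.one_mulVec]

/-- OPERATOR NORM transfers (the chart ∕ `‖M₂‖ ≤ μ` letters): `(∀ v, (Tm v) ⬝ᵥ (Tm v) ≤ N²·(v ⬝ᵥ v)) ⟹ ‖T‖ ≤ N` (`N ≥ 0`). [folklore] -/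
theorem opNorm_transfer (hT : ∀ g, ofLp (T g) = Tm *ᵥ ofLp g) {N : ℝ} (hN : 0 ≤ N)
    (h : ∀ v : κ → ℝ, (Tm *ᵥ v) ⬝ᵥ (Tm *ᵥ v) ≤ N ^ 2 * (v ⬝ᵥ v)) : ‖T‖ ≤ N := by
  refine ContinuousLinearMap.opNorm_le_bound T hN fun g => ?_
  have hn1 : ‖T g‖ ^ 2 = ofLp (T g) ⬝ᵥ ofLp (T g) := by rw [EuclideanSpace.norm_sq_eq]; simp [dotProduct, sq]
  have hn2 : ‖g‖ ^ 2 = ofLp g ⬝ᵥ ofLp g := by rw [EuclideanSpace.norm_sq_eq]; simp [dotProduct, sq]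
  have h2 : ‖T g‖ ^ 2 ≤ (N * ‖g‖) ^ 2 := by
    rw [hn1, hT, mul_pow, hn2]; exact h _
  have hy : 0 ≤ N * ‖g‖ := mul_nonneg hN (norm_nonneg g)
  nlinarith [h2, norm_nonneg (T g), hy]

/-- THE TRANSPORTED FORM IS A MATRIX FORM AGAIN: `(Q.bilinearComp T T) g h = g ⬝ᵥ ((Tmᵀ A Tm) h)` — so every letter above applies to
`Q.bilinearComp T T` with the matrix `Tmᵀ * A * Tm`, and the transfer iterates along a tower. [folklore] -/
theorem bilinearComp_transfer (hQ : ∀ x y, Q x y = ofLp x ⬝ᵥ (A *ᵥ ofLp y)) (hT : ∀ g, ofLp (T g) = Tm *ᵥ ofLp g)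
    (g h : EuclideanSpace ℝ κ) : (Q.bilinearComp T T) g h = ofLp g ⬝ᵥ ((Tmᵀ * A * Tm) *ᵥ ofLp h) := by
  rw [ContinuousLinearMap.bilinearComp_apply, hQ, hT, hT, ← Matrix.mulVec_mulVec, ← Matrix.mulVec_mulVec]
  conv_rhs => rw [Matrix.dotProduct_mulVec, Matrix.vecMul_transpose]

omit [Fintype κ] in
/-- KERNEL transfers: `D x = 0 ↔ Dm (ofLp x) = 0`. [folklore] -/
theorem ker_transfer (hD : ∀ x, ofLp (D x) = Dm *ᵥ ofLp x) (x : EuclideanSpace ℝ ι) : D x = 0 ↔ Dm *ᵥ ofLp x = 0 := by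
  rw [eq_zero_iff_ofLp, hD]

end Transfer

/-! ## §4. Toy -/

/-- Toy (`ι = κ = Fin 1`, `A = 1`): the form of the identity matrix is `1`-coercive on `EuclideanSpace ℝ (Fin 1)`. -/
example : ∃ Q : EuclideanSpace ℝ (Fin 1) →L[ℝ] EuclideanSpace ℝ (Fin 1) →L[ℝ] ℝ, ∀ x, (1 : ℝ) * ‖x‖ ^ 2 ≤ Q x x := by
  obtain ⟨Q, hQ⟩ := exists_form (ι := Fin 1) (1 : Matrix (Fin 1) (Fin 1) ℝ)
  exact ⟨Q, coercive_transfer hQ fun v => by rw [Matrix.one_mulVec, one_mul]⟩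

end Summit.QuantumFields.BalabanUV.T4Continuum.NE7b.MatrixFormJunction
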